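import Summits.BirchSwinnertonDyer.Rank1Residual.Additive.GordCycLeadingTerm
import Literature.NumberTheory.EllipticCurves.Delbourgo2002.PAdicBSDLeadingTerm
import Literature.NumberTheory.EllipticCurves.Wuthrich2014.RankOneEngineProofs
import HarnessLib

/-!
# O7-ord / N10, the LOWER half in Iwasawa currency: ONE typed input — "the `p`-adic analytic leading
# term `q · Reg_p` DIVIDES the algebraic leading term of `X(E/ℚ_∞)`" — its consumer through
# Delbourgo 2002 Thm. (B), and the proof that on those rows it is EXACTLY the lower half
# (cell `b2b-bsdres`, team n1011, seat p01, OWNERS row T-O7)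

HONEST FRAMING (cell `b2b-bsdres`, run/shared/lean/b2b/bsd-rank1-residual/, verbatim in every
file): prove what is provable now; shrink each hard class to its core with data; no claim beyond
stated classes. Research routes; census output = EVIDENCE / conjecture items, never a Literature
fact; RESIDUAL-MAP marks change only by signed lines. Team n1011 (N10 / N11, with the O7 rank-one
strand): §I O7 stays OPEN and N10 stays CONSTRUCTION; nothing is booked; no label changes. ONE
definition (a TYPED MISSING INPUT, `@[conjecture]`, our obligation — nothing asserted) and theorems;
NO Literature fact is minted: the published input (Delbourgo, J. Number Theory 95 (2002) Thm. (A),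
(B)) enters ONLY as the explicit binder `Literature.….Delbourgo2002.mainTheorem` (A175, additive-p2
GEN 18, p248323) or through its clause-predicate `Delbourgo2002.LeadingTermClauses W p Dh`.
COVERAGE GAP (referee 1 proviso (1) of ACK-1 T-O7, 2026-08-21T05:20Z — stated first): A175 as typed
covers `p ≥ 5`, potentially GOOD ordinary, non-CM curves only, whereas O7-ord's bulk is `p = 3` (X4
r = 1 @3: 10 677 of 11 602 cells; X3 r = 1 @3: 18 875) and the potentially multiplicative rows; both
lie inside the PRINTED Hypothesis of Delbourgo 2002 (p. 39) and await A175's `TODO(general form)` —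
the class forms therefore reach a SMALL sub-population today, and §1–§2 below are written against the
clause predicate so that they apply verbatim to any such extension. The rank-1 Schneider rider
(`hS : SchneiderConjecture Dh`) is an explicit binder, discharged per pair only as EVIDENCE (rmap-2 g7
three-engine certificate), never numerically in the kernel (proviso (2)).

## What and why

RESIDUAL-MAP §D, rank-one column, potentially ORDINARY additive prime (§I **O7-ord**, 11 505 S-b
pairs): "the leading-term machinery is LARGELY IN PRINT — Delbourgo 2002 (A) `Λ`-torsion, (B) the
algebraic `p`-adic BSD leading-term formula (given `#Ш[p^∞] < ∞` and non-degeneracy of `⟨,⟩_{p,ℚ}`),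
(C) the rational Kato divisibility; missing: X_D1 (the Main Conjecture (G)/(M) of Delbourgo 1998,
p. 151) + the Disegni↔Delbourgo comparison + Schneider non-degeneracy per pair (certified
numerically on 11 505 / 11 505 pairs, rmap-2 g7, EVIDENCE)". In rank `0` the same cell is §I **N10**
(the LOWER half `ord_p #Ш_an ≤ ord_p #Ш`). This file types the ONE statement that the `p`-part of
BSD needs from that missing machinery, uniformly in the rank `r = rank_ℤ E(ℚ)`:

* `CycLowerBoundAt W p Dh` (§0, `@[conjecture]`, nothing asserted): for the cyclotomic `ℤ_p`-extension,
  every Pontryagin-dual datum `D` of `Sel_{p^∞}(E/ℚ_∞)` and every generator `fE` of `char_Λ X(E/ℚ_∞)`: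
  `L^{(r)}(E,1)/r! = q · Ω_E · Reg_∞(E)` with `q ∈ ℚ` and
  `[T^r] fE · log_p(γ_cyc)^r = c · q · Reg_p(E, Dh)` with `c ∈ ℤ_p`.
  In words: the analytic `p`-adic leading term `q · Reg_p` predicted by Delbourgo's `p`-adic BSD
  conjecture for non-semistable reduction (Compositio 113 (1998) §2.5 (ii), "BS-D(p)";
  JNT 95 (2002) p. 39: "the non-semistable `p`-adic Birch, Swinnerton–Dyer conjecture which was
  formulated in [De]") DIVIDES the algebraic leading term of `X(E/ℚ_∞)` — the Eisenstein / lower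
  half of [Main Conjecture (G)/(M) ∘ BS-D(p)(ii) ∘ classical leading term], with every `p`-adic
  multiplier (Delbourgo's `p/(α·G(ε))`, `ℓ_p(E)`, the Disegni↔Delbourgo constant) absorbed into the
  cofactor `c`: only `c ∈ ℤ_p` is asked. `Dh : PAdicHeightData W p` is an explicit height datum
  (intended: Delbourgo's `⟨,⟩_{p,ℚ} := [K:ℚ]⁻¹⟨,⟩^{Sch}_{p,K}`, JNT 95 p. 39; not constructed in the
  tree — same vacuity flag as A175: every consumer takes `LeadingTermClauses W p Dh` for the SAME
  datum, which pins `ord_p Reg_p(Dh)` to Delbourgo's). Rank `0`: `Reg_p = 1`, `q = L(E,1)/Ω_E`, the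
  statement is "`q ∣ fE(0)` in `ℤ_p`" — N10's lower half in Iwasawa currency.
* CONSUMER (§1, class-agnostic): (B)-clauses for `Dh` + (A)-torsion + `Reg_p(Dh) ≠ 0` + GZK +
  `r_an ≤ 1` + `CycLowerBoundAt W p Dh` ⟹ `#Ш_an = s ∈ ℚ` with `ord_p s ≤ ord_p #Ш(E) + ord_p ℓ`,
  `ℓ ∣ p²` Delbourgo's factor (`= 1` off the anomalous rows) — hence `Typed.MissingLowerBoundAt W p`
  on the non-anomalous rows (`missingLowerBoundAt_of_cycLowerBound`). Mechanism:
  `[T^r]fE·log^r·#tors² = u·ℓ·#Ш[p^∞]·Reg_p·∏c_ℓ` ((B), `u ∈ ℤ_p^×`) and `[T^r]fE·log^r = c·q·Reg_p`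
  (typed) give, after cancelling `Reg_p ≠ 0`, `c·q·#tors² = u·ℓ·#Ш[p^∞]·∏c_ℓ`, and
  `#Ш_an = q·#tors²/∏c_ℓ` (`shaAn_def`).
* CONVERSE (§2): on the same rows `Typed.MissingLowerBoundAt W p` (and modularity: `L^{(r)}(E,1) ≠ 0`)
  implies `CycLowerBoundAt W p Dh` — so the typed input is EXACTLY the lower half there, not a
  stronger conjecture (`cycLowerBoundAt_iff_missingLowerBoundAt`).
* CLASS FORMS on Delbourgo's (G)-ordinary cell at `p ≥ 5`, non-CM (A175's binders verbatim:
  `Addv W p`, `TypeGOrd W p`) are in the companion file `Additive/GordCycLowerBoundClass.lean`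
  (`ClassX4Gord.missingLowerBoundAt_rankLeOne_of_cycLowerBound`, `ClassX3Gord.…`, rank `0` with the
  Schneider clause discharged).

COVERAGE: see the first paragraph (the printed Theorem also covers `ord_p j < 0` at `p ≥ 5`, with
`ℓ_p = 1` there, and `p = 3` with semistable reduction over a quadratic extension of `ℚ₃` — JNT 95
p. 39). The UPPER half is NOT touched by this file (rank 0: Kim 2026 / Kato–Wuthrich components /
Delbourgo 1998 Prop. 4, additive-p2/p4; rank 1: Kolyvagin, additive-p1
`bsdp_of_classX4_of_lowerHalves`, whose lower-half hypotheses this file's consumer feeds).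

References: D. Delbourgo, J. Number Theory 95 (2002) 38–71, Hypothesis + `ℓ_p`, `⟨,⟩_{p,ℚ}` (p. 39),
Theorem (A)–(D) (p. 40) [Delbourgo2002]; D. Delbourgo, Compositio Math. 113 (1998) 123–154, §2.5
Main Conjecture (p. 151), BS-D(p) (pp. 151–152) [Delbourgo1998]; R. L. Miller, LMS J. Comput.
Math. 14 (2011) Def. 1.1 [Miller2011LMS]; J. S. Balakrishnan, J. S. Müller, W. A. Stein, Math. Comp.
85 (2016) Thm. 1.7 (the good ordinary shape) [BalakrishnanMullerStein2015].
-/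

noncomputable section

open scoped Classical NumberField

open WeierstrassCurve NumberField Literature.NumberTheory.EllipticCurves
  Literature.NumberTheory.EllipticCurves.Rank1Residual
  Literature.NumberTheory.EllipticCurves.Rank1Residual.Typed
  Literature.NumberTheory.EllipticCurves.Delbourgo2002
  IsDedekindDomain

namespace Summit.BirchSwinnertonDyer.Rank1Residual.Additive

/-! ### §0 The typed input -/

/-- **TYPED MISSING INPUT (O7-ord / N10, Iwasawa currency; nothing asserted).** For the globally
minimal `W = E`, the prime `p` and a `p`-adic height datum `Dh` on `E(ℚ)`: for the cyclotomic
`ℤ_p`-extension `κ` of `ℚ` with a topological generator `γ` matching the cyclotomic variable, EVERY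
Pontryagin-dual datum `D` of `Sel_{p^∞}(E/ℚ_∞)` and EVERY generator `fE` of `char_Λ X(E/ℚ_∞)`,
`L^{(r)}(E,1)/r! = q · Ω_E · Reg_∞(E)` for a rational `q`, and
`[T^r] fE · log_p(γ_cyc)^r = c · q · Reg_p(E, Dh)` for some `c ∈ ℤ_p`, where `r = rank_ℤ E(ℚ)`:
the `p`-adic analytic leading term `q · Reg_p` of Delbourgo's BS-D(p) conjecture (ii) DIVIDES the
algebraic leading term of `X(E/ℚ_∞)` in `ℤ_p` — the Eisenstein (lower-bound) half of Delbourgo's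
Main Conjecture (G)/(M) composed with BS-D(p)(ii) and the classical leading term, all `p`-adic
multipliers absorbed in `c`. Intended `Dh`: Delbourgo's `⟨,⟩_{p,ℚ}` (JNT 95 (2002) p. 39). Rank `0`:
`q = L(E,1)/Ω_E` and the statement reads `q ∣ fE(0)`. OPEN (no divisibility of this direction is in
print at an additive prime: Delbourgo 1998 p. 151 states the Main Conjecture; 2002 Thm. (C) is the
RATIONAL Kato-side divisibility). A predicate on `(W, p, Dh)`; nothing asserted.
[cite: Delbourgo1998, §2.5 Main Conjecture (p. 151) and BS-D(p) (i)(ii) (pp. 151–152) (shape only; nothing asserted)]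
[cite: Delbourgo2002, p. 39 (⟨,⟩_{p,ℚ}, Reg_p) and Theorem (B) (p. 40) (shape only)] -/
@[conjecture] def CycLowerBoundAt (W : WeierstrassCurve ℚ) [W.IsElliptic] (p : ℕ) [Fact p.Prime]
    (Dh : PAdicHeightData W p) : Prop :=
  ∀ (κ : ZpExtension ℚ p) (γ : Field.absoluteGaloisGroup ℚ),
    κ.IsCyclotomic → κ.IsTopGenerator γ → IsCyclotomicVariable p γ →
    ∀ (D : W.SelmerDualData κ γ) (fE : IwasawaAlgebra p), D.charIdeal = Ideal.span {fE} →
      ∃ (q : ℚ) (c : ℤ_[p]),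
        W.leadingLCoeff = (q : ℂ) * (W.realPeriodRat : ℂ) * (W.regulator : ℂ) ∧
        ((PowerSeries.coeff W.mordellWeilRank fE : ℤ_[p]) : ℚ_[p]) *
            padicLog p (cyclotomicGenerator p) ^ W.mordellWeilRank =
          ((c : ℤ_[p]) : ℚ_[p]) * (q : ℚ_[p]) * padicRegulator Dh

/-- Unfolding lemma for `CycLowerBoundAt`. -/
theorem cycLowerBoundAt_iff (W : WeierstrassCurve ℚ) [W.IsElliptic] (p : ℕ) [Fact p.Prime]
    (Dh : PAdicHeightData W p) :
    CycLowerBoundAt W p Dh ↔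
      ∀ (κ : ZpExtension ℚ p) (γ : Field.absoluteGaloisGroup ℚ),
        κ.IsCyclotomic → κ.IsTopGenerator γ → IsCyclotomicVariable p γ →
        ∀ (D : W.SelmerDualData κ γ) (fE : IwasawaAlgebra p), D.charIdeal = Ideal.span {fE} →
          ∃ (q : ℚ) (c : ℤ_[p]),
            W.leadingLCoeff = (q : ℂ) * (W.realPeriodRat : ℂ) * (W.regulator : ℂ) ∧
            ((PowerSeries.coeff W.mordellWeilRank fE : ℤ_[p]) : ℚ_[p]) *
                padicLog p (cyclotomicGenerator p) ^ W.mordellWeilRank =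
              ((c : ℤ_[p]) : ℚ_[p]) * (q : ℚ_[p]) * padicRegulator Dh :=
  Iff.rfl

variable (W : WeierstrassCurve ℚ) [W.IsElliptic] (p : ℕ) [hp : Fact p.Prime]

/-! ### §1 The consumer: Delbourgo 2002 (B) + the typed input ⟹ the lower half -/

/-- **`#Ш_an` from the rational `q` of the leading term**: if `L^{(r)}(E,1)/r! = q · Ω_E · Reg_∞(E)`
then `#Ш_an(E) = q · #E(ℚ)_tors² / ∏_ℓ c_ℓ` (definition of `shaAn`; `Ω_E, Reg_∞ > 0`).
[cite: Miller2011LMS, §1 and Def. 1.1] -/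
theorem shaAn_eq_of_leadingLCoeff_eq {q : ℚ}
    (hq : W.leadingLCoeff = (q : ℂ) * (W.realPeriodRat : ℂ) * (W.regulator : ℂ)) :
    shaAn W = ((q * (W.torsionOrder : ℚ) ^ 2 / (W.tamagawaProduct : ℚ) : ℚ) : ℂ) := by
  have hΩ : (W.realPeriodRat : ℂ) ≠ 0 := by exact_mod_cast W.realPeriodRat_pos_holds.ne'
  have hReg : (W.regulator : ℂ) ≠ 0 := by exact_mod_cast (regulator_pos_holds W).ne'
  have hTam : (W.tamagawaProduct : ℂ) ≠ 0 := by
    exact_mod_cast (W.tamagawaProduct_pos_holds : 0 < W.tamagawaProduct).ne'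
  rw [shaAn_def, hq]
  push_cast
  field_simp

/-- **CORE (class-agnostic, any rank `r_an ≤ 1`).** Let `W` be globally minimal with `r_an ≤ 1`,
`Dh` a `p`-adic height datum for which Delbourgo 2002 Thm. (B) holds (`hB : LeadingTermClauses W p Dh`)
with non-degenerate regulator (`hS`, Delbourgo's "⟨,⟩_{p,ℚ} is non-degenerate"; automatic in rank `0`),
`X(E/ℚ_∞)` `Λ`-torsion for every datum (`hA`, the shape of Thm. (A)), Gross–Zagier–Kolyvagin
(`hGZK`: rank `= r_an`, `Ш` finite). Then the typed input `CycLowerBoundAt W p Dh` yields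
`#Ш_an(E) = s ∈ ℚ` and Delbourgo's factor `ℓ ∣ p²` (`ℓ = 1` off the anomalous rows) with
**`ord_p s ≤ ord_p #Ш(E) + ord_p ℓ`**. Mechanism in the module docstring (cancel `Reg_p ≠ 0`; the
cofactor `c ∈ ℤ_p` has `v(c) ≥ 0`). [cite: Delbourgo2002, Theorem (A), (B) (p. 40)]
[cite: Miller2011LMS, Def. 1.1] -/
theorem exists_shaAn_padicValRat_le_of_cycLowerBound {Dh : PAdicHeightData W p}
    (hB : LeadingTermClauses W p Dh) (hS : SchneiderConjecture Dh)
    (hA : ∀ (κ : ZpExtension ℚ p) (γ : Field.absoluteGaloisGroup ℚ),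
      κ.IsCyclotomic → κ.IsTopGenerator γ → ∀ D : W.SelmerDualData κ γ, D.IsTorsion)
    (hGZK : rank_eq_analyticRank_of_analyticRank_le_one) (hr : W.analyticRank ≤ 1)
    (hlow : CycLowerBoundAt W p Dh) :
    ∃ (s : ℚ) (ℓ : ℕ), shaAn W = (s : ℂ) ∧ ℓ ∣ p ^ 2 ∧ (ReductionNonAnomalous W p → ℓ = 1) ∧
      padicValRat p s ≤ (padicValNat p W.shaOrder : ℤ) + padicValNat p ℓ := by
  have hpP : p.Prime := hp.out
  -- Gross–Zagier–Kolyvagin: `Ш` finite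
  obtain ⟨-, hfin⟩ := hGZK W hr
  haveI : Finite W.sha := hfin
  have hfinp : Finite (AddCommGroup.primaryComponent W.sha p) := inferInstance
  -- the cyclotomic setting, a dual datum, a generator of the characteristic ideal
  obtain ⟨κ, hκ, γ, hγ, hγ'⟩ := exists_isCyclotomic_isTopGenerator_isCyclotomicVariable_holds p
  obtain ⟨D⟩ := W.nonempty_selmerDualData_holds κ γ hγ
  haveI : Module.Finite (IwasawaAlgebra p) D.X := D.module_finite_holds hγ
  haveI : (Module.charIdeal (IwasawaAlgebra p) D.X).IsPrincipal := charIdeal_isPrincipal_holds p D.X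
  obtain ⟨fE, hchar⟩ := Submodule.IsPrincipal.principal (Module.charIdeal (IwasawaAlgebra p) D.X)
  have hchar' : D.charIdeal = Ideal.span {fE} := hchar
  have hX : D.IsTorsion := hA κ γ hκ hγ D
  -- Delbourgo 2002 (B), clause 3
  obtain ⟨u, ℓ, hℓp, hℓ1, hBeq⟩ := hB.leadingCoeff hκ hγ hγ' D hX hchar' hS hfinp
  -- the typed input
  obtain ⟨q, c, hlead, hlowEq⟩ := hlow κ γ hκ hγ hγ' D fE hchar'
  -- abbreviations in `ℚ_p`
  set r := W.mordellWeilRank with hr_def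
  set A : ℚ_[p] := ((PowerSeries.coeff r fE : ℤ_[p]) : ℚ_[p]) *
    padicLog p (cyclotomicGenerator p) ^ r with hA_def
  set T2 : ℚ_[p] := (W.torsionOrder : ℚ_[p]) ^ 2 with hT2_def
  set Shp : ℚ_[p] := (Nat.card (AddCommGroup.primaryComponent W.sha p) : ℚ_[p]) with hShp_def
  set Rg : ℚ_[p] := padicRegulator Dh with hRg_def
  set Cc : ℚ_[p] := (W.tamagawaProduct : ℚ_[p]) with hCc_def
  set cQ : ℚ_[p] := ((c : ℤ_[p]) : ℚ_[p]) with hcQ_def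
  set uQ : ℚ_[p] := ((u : ℤ_[p]) : ℚ_[p]) with huQ_def
  -- `c · q · T2 · Rg = u · ℓ · Shp · Rg · Cc`
  have key : cQ * (q : ℚ_[p]) * T2 * Rg = uQ * (ℓ : ℚ_[p]) * Shp * Cc * Rg := by
    calc cQ * (q : ℚ_[p]) * T2 * Rg = (cQ * (q : ℚ_[p]) * Rg) * T2 := by ring
      _ = A * T2 := by rw [← hlowEq]
      _ = uQ * (ℓ : ℚ_[p]) * (Shp * Rg * Cc) := by rw [hA_def, hBeq]
      _ = uQ * (ℓ : ℚ_[p]) * Shp * Cc * Rg := by ring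
  have hRg0 : Rg ≠ 0 := hS
  have key2 : cQ * (q : ℚ_[p]) * T2 = uQ * (ℓ : ℚ_[p]) * Shp * Cc :=
    mul_right_cancel₀ hRg0 key
  -- non-vanishing
  have hu0 : uQ ≠ 0 := coe_units_ne_zero p u
  have hℓ0 : ℓ ≠ 0 := by
    rintro rfl
    exact hpP.ne_zero (pow_eq_zero_iff (n := 2) (by norm_num) |>.mp (zero_dvd_iff.mp hℓp))
  have hℓQ : (ℓ : ℚ_[p]) ≠ 0 := by exact_mod_cast hℓ0
  have hShp0 : Shp ≠ 0 := by rw [hShp_def]; exact_mod_cast Nat.card_pos.ne'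
  have hCc0 : Cc ≠ 0 := by
    rw [hCc_def]; exact_mod_cast (W.tamagawaProduct_pos_holds : 0 < W.tamagawaProduct).ne'
  have hT0 : W.torsionOrder ≠ 0 := (W.torsionOrder_pos_holds).ne'
  have hT2 : T2 ≠ 0 := by rw [hT2_def]; exact pow_ne_zero 2 (by exact_mod_cast hT0)
  have hrhs : uQ * (ℓ : ℚ_[p]) * Shp * Cc ≠ 0 :=
    mul_ne_zero (mul_ne_zero (mul_ne_zero hu0 hℓQ) hShp0) hCc0
  have hlhs : cQ * (q : ℚ_[p]) * T2 ≠ 0 := by rw [key2]; exact hrhs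
  have hc0 : cQ ≠ 0 := fun h ↦ hlhs (by rw [h]; ring)
  have hqQ : ((q : ℚ) : ℚ_[p]) ≠ 0 := fun h ↦ hlhs (by rw [h]; ring)
  have hq0 : q ≠ 0 := fun h ↦ hqQ (by rw [h, Rat.cast_zero])
  -- valuations
  have hval := congrArg Padic.valuation key2
  rw [Padic.valuation_mul (mul_ne_zero hc0 hqQ) hT2, Padic.valuation_mul hc0 hqQ,
    Padic.valuation_mul (mul_ne_zero (mul_ne_zero hu0 hℓQ) hShp0) hCc0,
    Padic.valuation_mul (mul_ne_zero hu0 hℓQ) hShp0, Padic.valuation_mul hu0 hℓQ,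
    huQ_def, valuation_coe_units_eq_zero, zero_add, Padic.valuation_ratCast, hT2_def,
    Padic.valuation_pow, Padic.valuation_natCast, Padic.valuation_natCast, hShp_def,
    Padic.valuation_natCast, padicValNat_card_addPrimaryComponent, hCc_def,
    Padic.valuation_natCast] at hval
  have hcnn : 0 ≤ cQ.valuation := PadicInt.valuation_coe_nonneg
  -- the analytic order of `Ш`
  set s : ℚ := q * (W.torsionOrder : ℚ) ^ 2 / (W.tamagawaProduct : ℚ) with hs_def
  refine ⟨s, ℓ, shaAn_eq_of_leadingLCoeff_eq W hlead, hℓp, hℓ1, ?_⟩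
  have hTq : (W.torsionOrder : ℚ) ≠ 0 := by exact_mod_cast hT0
  have hPq : (W.tamagawaProduct : ℚ) ≠ 0 := by
    exact_mod_cast (W.tamagawaProduct_pos_holds : 0 < W.tamagawaProduct).ne'
  rw [hs_def, padicValRat.div (mul_ne_zero hq0 (pow_ne_zero 2 hTq)) hPq,
    padicValRat.mul hq0 (pow_ne_zero 2 hTq), padicValRat.pow, padicValRat.of_nat,
    padicValRat.of_nat, WeierstrassCurve.shaOrder]
  push_cast at hval ⊢
  linarith

/-- **The lower half on the non-anomalous rows.** In the setting of
`exists_shaAn_padicValRat_le_of_cycLowerBound`, if the reduction over the (G)-fields is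
non-anomalous (`ReductionNonAnomalous W p`, Delbourgo's `ℓ_p(E) = 1`), the typed input gives
`Typed.MissingLowerBoundAt W p` (`ord_p #Ш_an ≤ ord_p #Ш`). [cite: Delbourgo2002, Theorem (B) (p. 40), ℓ_p(E) (p. 39)]
[cite: Miller2011LMS, Def. 1.1] -/
theorem missingLowerBoundAt_of_cycLowerBound {Dh : PAdicHeightData W p}
    (hB : LeadingTermClauses W p Dh) (hS : SchneiderConjecture Dh)
    (hA : ∀ (κ : ZpExtension ℚ p) (γ : Field.absoluteGaloisGroup ℚ),
      κ.IsCyclotomic → κ.IsTopGenerator γ → ∀ D : W.SelmerDualData κ γ, D.IsTorsion)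
    (hGZK : rank_eq_analyticRank_of_analyticRank_le_one) (hr : W.analyticRank ≤ 1)
    (hna : ReductionNonAnomalous W p) (hlow : CycLowerBoundAt W p Dh) :
    MissingLowerBoundAt W p := by
  obtain ⟨s, ℓ, hs, -, hℓ1, hle⟩ :=
    exists_shaAn_padicValRat_le_of_cycLowerBound W p hB hS hA hGZK hr hlow
  refine ⟨s, hs, ?_⟩
  rw [hℓ1 hna, padicValNat_one_right, Nat.cast_zero, add_zero] at hle
  exact hle

/-- **Rank `0`: no height hypothesis.** With `r_an = 0` the regulator of every datum is `1`
(`padicRegulator_eq_one_of_finite`), so Schneider's clause is automatic and the typed input reads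
`L(E,1)/Ω_E ∣ fE(0)`: (B) + (A) + GZK + non-anomalous + `CycLowerBoundAt W p Dh` ⟹
`Typed.MissingLowerBoundAt W p` — N10's lower half on Delbourgo's cell, Iwasawa currency.
[cite: Delbourgo2002, Theorem (B) (p. 40), case r_E = 0] [cite: Miller2011LMS, Def. 1.1] -/
theorem missingLowerBoundAt_rankZero_of_cycLowerBound {Dh : PAdicHeightData W p}
    (hB : LeadingTermClauses W p Dh)
    (hA : ∀ (κ : ZpExtension ℚ p) (γ : Field.absoluteGaloisGroup ℚ),
      κ.IsCyclotomic → κ.IsTopGenerator γ → ∀ D : W.SelmerDualData κ γ, D.IsTorsion)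
    (hGZK : rank_eq_analyticRank_of_analyticRank_le_one) (hr : W.analyticRank = 0)
    (hna : ReductionNonAnomalous W p) (hlow : CycLowerBoundAt W p Dh) :
    MissingLowerBoundAt W p := by
  obtain ⟨hmw, -⟩ := hGZK W (by rw [hr]; exact zero_le_one)
  have hmw0 : W.mordellWeilRank = 0 := by rw [hmw, hr]
  haveI : Finite W.toAffine.Point := W.finite_point_of_rank_zero hmw0
  have hS : SchneiderConjecture Dh := by
    rw [SchneiderConjecture, padicRegulator_eq_one_of_finite W p Dh]
    exact one_ne_zero
  exact missingLowerBoundAt_of_cycLowerBound W p hB hS hA hGZK (by rw [hr]; exact zero_le_one) hna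
    hlow

/-! ### §2 The converse: on these rows the typed input is EXACTLY the lower half -/

/-- **CONVERSE.** In the setting of `missingLowerBoundAt_of_cycLowerBound` (Delbourgo 2002 (B) for
`Dh` with `Reg_p(Dh) ≠ 0`, (A)-torsion, GZK, `r_an ≤ 1`, non-anomalous), granted modularity
(`hmod`, for `L^{(r)}(E,1) ≠ 0`), the lower half `Typed.MissingLowerBoundAt W p` IMPLIES the typed
input `CycLowerBoundAt W p Dh`: with `#Ш_an = s`, `q := s · ∏c_ℓ / #tors²` and, for each datum and
generator, `c := u · #Ш[p^∞] · ∏c_ℓ / (q · #tors²) = u · #Ш[p^∞] / s`, whose valuation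
`ord_p #Ш − ord_p s ≥ 0` makes it an element of `ℤ_p`. So the typed input conjectures NOTHING beyond
the `p`-part of BSD on these rows. [cite: Delbourgo2002, Theorem (A), (B) (p. 40)] [cite: Miller2011LMS, Def. 1.1] -/
theorem cycLowerBoundAt_of_missingLowerBoundAt {Dh : PAdicHeightData W p}
    (hB : LeadingTermClauses W p Dh) (hS : SchneiderConjecture Dh)
    (hA : ∀ (κ : ZpExtension ℚ p) (γ : Field.absoluteGaloisGroup ℚ),
      κ.IsCyclotomic → κ.IsTopGenerator γ → ∀ D : W.SelmerDualData κ γ, D.IsTorsion)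
    (hGZK : rank_eq_analyticRank_of_analyticRank_le_one) (hmod : hasEntireLFunction_rat)
    (hr : W.analyticRank ≤ 1) (hna : ReductionNonAnomalous W p) (hmiss : MissingLowerBoundAt W p) :
    CycLowerBoundAt W p Dh := by
  have hpP : p.Prime := hp.out
  obtain ⟨-, hfin⟩ := hGZK W hr
  haveI : Finite W.sha := hfin
  have hfinp : Finite (AddCommGroup.primaryComponent W.sha p) := inferInstance
  obtain ⟨s, hs, hsle⟩ := hmiss
  -- positivity of the BSD quantities
  have hΩpos : 0 < W.realPeriodRat := W.realPeriodRat_pos_holds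
  have hRegpos : 0 < W.regulator := regulator_pos_holds W
  have hT0 : W.torsionOrder ≠ 0 := (W.torsionOrder_pos_holds).ne'
  have hTq : (W.torsionOrder : ℚ) ≠ 0 := by exact_mod_cast hT0
  have hPpos : 0 < W.tamagawaProduct := W.tamagawaProduct_pos_holds
  have hPq : (W.tamagawaProduct : ℚ) ≠ 0 := by exact_mod_cast hPpos.ne'
  -- the rational `q` of the leading term
  set q : ℚ := s * (W.tamagawaProduct : ℚ) / (W.torsionOrder : ℚ) ^ 2 with hq_def
  have hlead : W.leadingLCoeff = (q : ℂ) * (W.realPeriodRat : ℂ) * (W.regulator : ℂ) := by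
    have hΩC : (W.realPeriodRat : ℂ) ≠ 0 := by exact_mod_cast hΩpos.ne'
    have hRegC : (W.regulator : ℂ) ≠ 0 := by exact_mod_cast hRegpos.ne'
    have hTC : (W.torsionOrder : ℂ) ≠ 0 := by exact_mod_cast hT0
    have hPC : (W.tamagawaProduct : ℂ) ≠ 0 := by exact_mod_cast hPpos.ne'
    have h := hs
    rw [shaAn_def] at h
    rw [hq_def]
    push_cast
    rw [div_eq_iff (mul_ne_zero (mul_ne_zero hΩC hPC) hRegC)] at h
    field_simp
    linear_combination h
  -- `L^{(r)}(E,1) ≠ 0`, hence `s ≠ 0`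
  have hL0 : W.leadingLCoeff ≠ 0 := W.leadingLCoeff_ne_zero_holds (hmod W)
  have hs0 : s ≠ 0 := by
    intro h0
    apply hL0
    rw [hlead, hq_def, h0]
    simp
  intro κ γ hκ hγ hγ' D fE hchar
  haveI : Module.Finite (IwasawaAlgebra p) D.X := D.module_finite_holds hγ
  have hX : D.IsTorsion := hA κ γ hκ hγ D
  obtain ⟨u, hBeq⟩ := hB.leadingCoeff_of_nonAnomalous hκ hγ hγ' D hX hchar hS hfinp hna
  -- abbreviations
  set r := W.mordellWeilRank with hr_def
  set A : ℚ_[p] := ((PowerSeries.coeff r fE : ℤ_[p]) : ℚ_[p]) *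
    padicLog p (cyclotomicGenerator p) ^ r with hA_def
  set Shp : ℚ_[p] := (Nat.card (AddCommGroup.primaryComponent W.sha p) : ℚ_[p]) with hShp_def
  set uQ : ℚ_[p] := ((u : ℤ_[p]) : ℚ_[p]) with huQ_def
  -- the cofactor `c = u · #Ш[p^∞] / s`
  set cQ : ℚ_[p] := uQ * Shp / ((s : ℚ) : ℚ_[p]) with hcQ_def
  have hsQ : ((s : ℚ) : ℚ_[p]) ≠ 0 := by exact_mod_cast hs0
  have hu0 : uQ ≠ 0 := coe_units_ne_zero p u
  have hShp0 : Shp ≠ 0 := by rw [hShp_def]; exact_mod_cast Nat.card_pos.ne'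
  have hc0 : cQ ≠ 0 := by
    rw [hcQ_def]; exact div_ne_zero (mul_ne_zero hu0 hShp0) hsQ
  have hprod : cQ * ((s : ℚ) : ℚ_[p]) = uQ * Shp := by
    rw [hcQ_def]; field_simp
  have hcval : 0 ≤ cQ.valuation := by
    have hv := congrArg Padic.valuation hprod
    rw [Padic.valuation_mul hc0 hsQ, Padic.valuation_mul hu0 hShp0, huQ_def,
      valuation_coe_units_eq_zero, zero_add, Padic.valuation_ratCast, hShp_def,
      Padic.valuation_natCast, padicValNat_card_addPrimaryComponent] at hv
    rw [WeierstrassCurve.shaOrder] at hsle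
    linarith
  refine ⟨q, ⟨cQ, (Padic.norm_le_one_iff_val_nonneg cQ).mpr hcval⟩, hlead, ?_⟩
  have hT2Q : (W.torsionOrder : ℚ_[p]) ^ 2 ≠ 0 := pow_ne_zero 2 (by exact_mod_cast hT0)
  have hCcQ : (W.tamagawaProduct : ℚ_[p]) ≠ 0 := by exact_mod_cast hPpos.ne'
  have hAeq : A = uQ * Shp * padicRegulator Dh * (W.tamagawaProduct : ℚ_[p]) /
      (W.torsionOrder : ℚ_[p]) ^ 2 := by
    rw [eq_div_iff hT2Q, hA_def, hBeq]
    ring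
  show A = cQ * ((q : ℚ) : ℚ_[p]) * padicRegulator Dh
  rw [hAeq, hcQ_def, hq_def]
  push_cast
  field_simp

/-- **`iff`: on Delbourgo's rows the typed input IS the lower half.** [cite: Delbourgo2002, Theorem (A), (B) (p. 40)]
[cite: Miller2011LMS, Def. 1.1] -/
theorem cycLowerBoundAt_iff_missingLowerBoundAt {Dh : PAdicHeightData W p}
    (hB : LeadingTermClauses W p Dh) (hS : SchneiderConjecture Dh)
    (hA : ∀ (κ : ZpExtension ℚ p) (γ : Field.absoluteGaloisGroup ℚ),
      κ.IsCyclotomic → κ.IsTopGenerator γ → ∀ D : W.SelmerDualData κ γ, D.IsTorsion)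
    (hGZK : rank_eq_analyticRank_of_analyticRank_le_one) (hmod : hasEntireLFunction_rat)
    (hr : W.analyticRank ≤ 1) (hna : ReductionNonAnomalous W p) :
    CycLowerBoundAt W p Dh ↔ MissingLowerBoundAt W p :=
  ⟨missingLowerBoundAt_of_cycLowerBound W p hB hS hA hGZK hr hna,
    cycLowerBoundAt_of_missingLowerBoundAt W p hB hS hA hGZK hmod hr hna⟩

end Summit.BirchSwinnertonDyer.Rank1Residual.Additive

end
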